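import Literature.Geometry.Riemannian.LinearHeatWeakRegularity
import HarnessLib

/-!
# Hypoellipticity of the heat operator on a (non-compact) manifold

Topic `Geometry/Riemannian`; the non-compact companion of `LinearHeatWeakRegularity.lean`, whose interior
regularity theorem `exists_contMDiffOn_ae_eq_of_linearHeat_veryWeak` and measure-transfer lemmas
(`ae_prod_chart_of_ae_volume`, `locallyIntegrableOn_comp_chart_prod`, `integral_heatTranspose_chart_of_veryWeak`)
carry `[CompactSpace M]` only to synthesise `T3Space M` (to state the Riemannian measure) and to get
`SFinite dV_{g₀}` for Tonelli. Here they are re-proved for a manifold that is merely `T₃` and second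
countable: the Riemannian measure is finite on compact sets (`riemannianVolume_lt_top_of_isCompact_holds`),
the manifold is locally compact, hence the measure is locally finite and σ-finite.

* `ae_prod_chart_of_ae_volume_nc`, `locallyIntegrableOn_comp_chart_prod_nc`,
  `integral_heatTranspose_chart_of_veryWeak_nc` — measure transfer and the very weak equation read in a
  space-time chart (`J = √det h(s)ᵢⱼ`, `A = J h(s)⁻¹`, `q = JQ`, `F = JG`);
* `exists_contMDiffOn_ae_eq_of_linearHeat_veryWeak_nc` — **interior regularity** for a family `h(s)` of
  Riemannian metrics on a `T₃` second-countable manifold modelled on `ℝᵐ` (general model with corners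
  `I`, boundaryless): a measurable, locally integrable very weak solution of `∂ₛu = Δ_{h(s)}u − Qu + G` on
  `M × T` agrees a.e. with a function smooth on `M × T` (Hörmander's theorem in each chart,
  `exists_contDiffOn_ae_eq_of_heat_veryWeak`, patched by `exists_contMDiffOn_ae_eq_of_forall_exists_nhds`);
* `exists_contMDiffOn_ae_eq_of_staticLinearHeat_veryWeak` — the static statement (`h ≡ g`, density
  ratio `1`) on a manifold modelled on `ℝⁿ`, the form consumed by `LinearHeatCauchyNoncompact.lean`.

This is the Literature home of the Summits-side `EntropyRungNoncompactShrinkerGapHeatHypoellipticNoncompact{,Aux,Chart}`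
(route SmoothPoincare4/EntropyRung; not importable from Literature, CONVENTIONS §2). Everything is proved;
no named facts.

## References

* L. Hörmander, *Hypoelliptic second order differential equations*, Acta Math. 119 (1967) 147–171,
  Thm 1.1. [Hormander1967]
* I. Chavel, *Riemannian Geometry: A Modern Introduction*, 2nd ed., CUP 2006, §III.3 (III.3.5)–(III.3.6),
  §III.7. [Chavel2006]
* H. Federer, *Geometric Measure Theory*, Springer 1969, §3.2.46. [Federer1969]
-/

noncomputable section

open Bundle Set Function Filter MeasureTheory Measure TopologicalSpace
open scoped Manifold ContDiff Topology Matrix ENNReal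

namespace Literature.Geometry.Riemannian

open Lorentzian Lorentzian.PseudoRiemannianMetric Literature.Analysis.Distribution

section General

variable {m : ℕ} {H : Type*} [TopologicalSpace H]
  {I : ModelWithCorners ℝ (EuclideanSpace ℝ (Fin m)) H}
  {M : Type*} [TopologicalSpace M] [ChartedSpace H M]
  [IsManifold I ∞ M] [T3Space M] [MeasurableSpace M] [BorelSpace M]
  {g₀ : PseudoRiemannianMetric I ∞ (EuclideanSpace ℝ (Fin m)) (TangentSpace I : M → Type _)}

/-- Null sets transfer from the chart target to the chart domain
(`φ_*(μ_h|source) = √g · vol|target ≪ vol`); non-compact `M`. [folklore] -/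
private theorem ae_source_of_ae_target_nc
    (G₀ : ContMDiffRiemannianMetric I ∞ (EuclideanSpace ℝ (Fin m)) (TangentSpace I : M → Type _)) (x : M)
    {P : EuclideanSpace ℝ (Fin m) → Prop}
    (hae : ∀ᵐ y ∂(volume : Measure (EuclideanSpace ℝ (Fin m))), P y) :
    ∀ᵐ p ∂riemannianMeasure G₀, p ∈ (extChartAt I x).source → P (extChartAt I x p) := by
  -- adapted from `Literature.Geometry.Riemannian.ae_source_of_ae_target`
  have hs : MeasurableSet (extChartAt I x).source := (isOpen_extChartAt_source x).measurableSet
  have h1 : ∀ᵐ y ∂((volume : Measure (EuclideanSpace ℝ (Fin m))).restrict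
      (extChartAt I x).target), P y := ae_restrict_of_ae hae
  have h2 : ∀ᵐ y ∂(((volume : Measure (EuclideanSpace ℝ (Fin m))).restrict
      (extChartAt I x).target).withDensity
        (fun y ↦ ENNReal.ofReal (Real.sqrt (chartGramMatrix G₀ x y).det))), P y :=
    (withDensity_absolutelyContinuous _ _).ae_le h1
  rw [← map_extChartAt_restrict_riemannianMeasure G₀ x] at h2
  have h3 := ae_of_ae_map (aemeasurable_extChartAt_restrict x (riemannianMeasure G₀)) h2
  rw [ae_restrict_iff' hs] at h3
  exact h3

/-- **Null sets transfer from the space-time chart to `M × ℝ`** (non-compact `M`): a property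
holding Lebesgue-a.e. on `ℝᵐ × ℝ` holds `(dV_{g₀} ⊗ ds)`-a.e. at `(φ p.1, p.2)` for `p.1` in the
chart domain (`g₀` Riemannian, `dV_{g₀} = g₀.riemVolume`). [folklore] -/
theorem ae_prod_chart_of_ae_volume_nc (hR₀ : g₀.IsRiemannian) (x : M) {P : (EuclideanSpace ℝ (Fin m) × ℝ) → Prop}
    (hae : ∀ᵐ q ∂(volume : Measure (EuclideanSpace ℝ (Fin m) × ℝ)), P q) :
    ∀ᵐ p ∂g₀.riemVolume.prod (volume : Measure ℝ),
      p.1 ∈ (extChartAt I x).source → P (extChartAt I x p.1, p.2) := by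
  -- adapted from `Literature.Geometry.Riemannian.ae_prod_chart_of_ae_volume`
  classical
  rw [riemVolume_eq hR₀]
  set G₀ := g₀.toContMDiffRiemannianMetric hR₀ with hG₀
  obtain ⟨N, hNsub, hNm, hN0⟩ := exists_measurable_superset_of_null
    (show (volume : Measure (EuclideanSpace ℝ (Fin m) × ℝ)) {q | ¬P q} = 0 from hae)
  have hvol : (volume : Measure (EuclideanSpace ℝ (Fin m) × ℝ)) =
      (volume : Measure (EuclideanSpace ℝ (Fin m))).prod (volume : Measure ℝ) := rfl
  rw [hvol] at hN0
  have h1 : ∀ᵐ y ∂(volume : Measure (EuclideanSpace ℝ (Fin m))),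
      (volume : Measure ℝ) (Prod.mk y ⁻¹' N) = 0 := measure_ae_null_of_prod_null hN0
  have h2 := ae_source_of_ae_target_nc G₀ x h1
  set S : Set (M × ℝ) := {p | p.1 ∈ (extChartAt I x).source ∧ (extChartAt I x p.1, p.2) ∈ N}
    with hS
  have hsrc : MeasurableSet (extChartAt I x).source := (isOpen_extChartAt_source x).measurableSet
  have hSm : MeasurableSet S := by
    have hm : Measurable (((extChartAt I x).source ×ˢ (univ : Set ℝ)).piecewise
        (fun p : M × ℝ ↦ ((extChartAt I x p.1, p.2) : (EuclideanSpace ℝ (Fin m) × ℝ))) fun _ ↦ (extChartAt I x x, 0)) := by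
      refine ContinuousOn.measurable_piecewise ?_ continuousOn_const (hsrc.prod MeasurableSet.univ)
      exact ((continuousOn_extChartAt x).comp continuous_fst.continuousOn
        (fun p hp ↦ hp.1)).prodMk continuous_snd.continuousOn
    have hS' : S = ((extChartAt I x).source ×ˢ (univ : Set ℝ)) ∩
        (((extChartAt I x).source ×ˢ (univ : Set ℝ)).piecewise
          (fun p : M × ℝ ↦ ((extChartAt I x p.1, p.2) : (EuclideanSpace ℝ (Fin m) × ℝ))) fun _ ↦ (extChartAt I x x, 0)) ⁻¹' N := by
      ext p
      simp only [hS, mem_setOf_eq, mem_inter_iff, mem_prod, mem_univ, and_true, Set.mem_preimage]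
      constructor
      · rintro ⟨hp, hpN⟩
        refine ⟨hp, ?_⟩
        rwa [piecewise_eq_of_mem _ _ _ (show p ∈ (extChartAt I x).source ×ˢ (univ : Set ℝ) from
          ⟨hp, mem_univ _⟩)]
      · rintro ⟨hp, hpN⟩
        refine ⟨hp, ?_⟩
        rwa [piecewise_eq_of_mem _ _ _ (show p ∈ (extChartAt I x).source ×ˢ (univ : Set ℝ) from
          ⟨hp, mem_univ _⟩)] at hpN
    rw [hS']
    exact (hsrc.prod MeasurableSet.univ).inter (hm hNm)
  have hS0 : ((riemannianMeasure G₀).prod (volume : Measure ℝ)) S = 0 := by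
    refine measure_prod_null_of_ae_null hSm ?_
    filter_upwards [h2] with p hp
    by_cases hps : p ∈ (extChartAt I x).source
    · have : Prod.mk p ⁻¹' S = Prod.mk (extChartAt I x p) ⁻¹' N := by
        ext t
        simp only [hS, Set.mem_preimage, mem_setOf_eq]
        exact ⟨fun h ↦ h.2, fun h ↦ ⟨hps, h⟩⟩
      rw [this]
      exact hp hps
    · have : Prod.mk p ⁻¹' S = ∅ := by
        ext t
        simp only [hS, Set.mem_preimage, mem_setOf_eq, mem_empty_iff_false, iff_false, not_and]
        exact fun h _ ↦ hps h
      rw [this, measure_empty, Pi.zero_apply]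
  rw [← compl_mem_ae_iff] at hS0
  filter_upwards [hS0] with p hp hps
  by_contra hP
  exact hp ⟨hps, hNsub hP⟩

/-- **Local integrability transfers to the space-time chart** (non-compact `M`): if `u` is
locally integrable on `M × T` (`T` open) for `dV_{g₀} ⊗ ds` (`g₀` Riemannian), then `(y, s) ↦ u(φ⁻¹ y, s)` is locally
integrable on `φ.target × T` for Lebesgue measure (the chart density is bounded below on compact
parts of the target; Tonelli on the manifold side uses σ-finiteness of `dV_{g₀}`, which holds
since it is finite on compact sets and `M` is locally compact and second countable).
[cite: Chavel2006, §III.3 (III.3.6)] -/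
theorem locallyIntegrableOn_comp_chart_prod_nc [I.Boundaryless] [SecondCountableTopology M]
    (hR₀ : g₀.IsRiemannian) (x : M)
    {T : Set ℝ} (hT : IsOpen T) {u : M × ℝ → ℝ} (hum : Measurable u)
    (hu : LocallyIntegrableOn u (univ ×ˢ T) (g₀.riemVolume.prod (volume : Measure ℝ))) :
    LocallyIntegrableOn (fun q : (EuclideanSpace ℝ (Fin m) × ℝ) ↦ u ((extChartAt I x).symm q.1, q.2))
      ((extChartAt I x).target ×ˢ T) (volume : Measure (EuclideanSpace ℝ (Fin m) × ℝ)) := by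
  -- adapted from `Literature.Geometry.Riemannian.locallyIntegrableOn_comp_chart_prod`
  rw [riemVolume_eq hR₀] at hu
  set G₀ := g₀.toContMDiffRiemannianMetric hR₀ with hG₀
  set φ := extChartAt I x with hφ
  have hTo : IsOpen (φ.target ×ˢ T) := (isOpen_extChartAt_target x).prod hT
  have hΨ : ContinuousOn (fun q : (EuclideanSpace ℝ (Fin m) × ℝ) ↦ ((φ.symm q.1, q.2) : M × ℝ)) (φ.target ×ˢ (Set.univ : Set ℝ)) :=
    ((continuousOn_extChartAt_symm x).comp continuous_fst.continuousOn
      (fun q hq ↦ hq.1)).prodMk continuous_snd.continuousOn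
  rw [locallyIntegrableOn_iff hTo.isLocallyClosed]
  intro K hKsub hK
  have hmeas : AEStronglyMeasurable (fun q : (EuclideanSpace ℝ (Fin m) × ℝ) ↦ u (φ.symm q.1, q.2))
      ((volume : Measure (EuclideanSpace ℝ (Fin m) × ℝ)).restrict K) := by
    have h1 : AEMeasurable (fun q : (EuclideanSpace ℝ (Fin m) × ℝ) ↦ ((φ.symm q.1, q.2) : M × ℝ))
        ((volume : Measure (EuclideanSpace ℝ (Fin m) × ℝ)).restrict K) :=
      (hΨ.mono (hKsub.trans (prod_mono le_rfl (subset_univ _)))).aemeasurable hK.measurableSet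
    exact (hum.comp_aemeasurable h1).aestronglyMeasurable
  refine ⟨hmeas, ?_⟩
  set K₁ : Set (EuclideanSpace ℝ (Fin m)) := Prod.fst '' K with hK₁
  have hK₁c : IsCompact K₁ := hK.image continuous_fst
  have hK₁T : K₁ ⊆ φ.target := by
    rintro _ ⟨q, hq, rfl⟩; exact (hKsub hq).1
  have hρc : ContinuousOn (fun y ↦ Real.sqrt (chartGramMatrix G₀ x y).det) φ.target :=
    (contDiffOn_sqrt_det_chartGramMatrix' G₀ x).continuousOn
  obtain ⟨lam, hlam, hlamle⟩ : ∃ lam : ℝ, 0 < lam ∧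
      ∀ y ∈ K₁, lam ≤ Real.sqrt (chartGramMatrix G₀ x y).det := by
    rcases K₁.eq_empty_or_nonempty with hKe | hKne
    · exact ⟨1, one_pos, fun y hy ↦ by rw [hKe] at hy; exact hy.elim⟩
    · obtain ⟨y₀, hy₀, hmin⟩ := hK₁c.exists_isMinOn hKne (hρc.mono hK₁T)
      exact ⟨_, sqrt_det_chartGramMatrix_pos G₀ x (hK₁T hy₀), fun y hy ↦ hmin hy⟩
  set K' : Set (M × ℝ) := (fun q : (EuclideanSpace ℝ (Fin m) × ℝ) ↦ ((φ.symm q.1, q.2) : M × ℝ)) '' K with hK'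
  have hK'c : IsCompact K' :=
    hK.image_of_continuousOn (hΨ.mono (hKsub.trans (prod_mono le_rfl (subset_univ _))))
  have hK'T : K' ⊆ (Set.univ : Set M) ×ˢ T := by
    rintro _ ⟨q, hq, rfl⟩; exact ⟨mem_univ _, (hKsub hq).2⟩
  have hfin : ∫⁻ p in K', ‖u p‖ₑ ∂(riemannianMeasure G₀).prod (volume : Measure ℝ) < ⊤ :=
    (hu.integrableOn_compact_subset hK'T hK'c).2
  have hKm : MeasurableSet K := hK.measurableSet
  have hK'm : MeasurableSet K' := hK'c.measurableSet
  -- σ-finiteness of the Riemannian measure (finite on compacts, locally compact, 2nd countable)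
  haveI : LocallyCompactSpace M := Manifold.locallyCompact_of_finiteDimensional (M := M) I
  haveI : IsFiniteMeasureOnCompacts (riemannianMeasure G₀) :=
    ⟨fun K hK ↦ riemannianVolume_lt_top_of_isCompact_holds G₀ le_rfl hK⟩
  have hslice : ∀ s : ℝ, ∫⁻ y, K.indicator (fun q : (EuclideanSpace ℝ (Fin m) × ℝ) ↦ ‖u (φ.symm q.1, q.2)‖ₑ) (y, s) ≤
      ENNReal.ofReal (1 / lam) *
        ∫⁻ p, K'.indicator (fun p : M × ℝ ↦ ‖u p‖ₑ) (p, s) ∂riemannianMeasure G₀ := by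
    intro s
    set F : M → ℝ≥0∞ := fun p ↦ K'.indicator (fun p : M × ℝ ↦ ‖u p‖ₑ) (p, s) with hF
    have hFm : Measurable F :=
      (hum.enorm.indicator hK'm).comp (measurable_id.prodMk measurable_const)
    have hFsupp : support F ⊆ φ.source := by
      intro p hp
      rw [mem_support, hF] at hp
      have hpK : (p, s) ∈ K' := by
        by_contra h'; exact hp (indicator_of_notMem h' _)
      obtain ⟨q, hq, hpq⟩ := hpK
      have : p = φ.symm q.1 := (congrArg Prod.fst hpq).symm
      rw [this]
      exact φ.map_target (hKsub hq).1
    have key : ∀ y, K.indicator (fun q : (EuclideanSpace ℝ (Fin m) × ℝ) ↦ ‖u (φ.symm q.1, q.2)‖ₑ) (y, s) ≤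
        ENNReal.ofReal (1 / lam) * (φ.target).indicator
          (fun y ↦ F (φ.symm y) * ENNReal.ofReal (Real.sqrt (chartGramMatrix G₀ x y).det)) y := by
      intro y
      by_cases hyK : (y, s) ∈ K
      · have hyT : y ∈ φ.target := (hKsub hyK).1
        have hyK₁ : y ∈ K₁ := ⟨(y, s), hyK, rfl⟩
        have hyK' : ((φ.symm y, s) : M × ℝ) ∈ K' := ⟨(y, s), hyK, rfl⟩
        rw [indicator_of_mem hyK, indicator_of_mem hyT, hF]
        dsimp only
        rw [indicator_of_mem hyK']
        have hρ := hlamle y hyK₁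
        calc ‖u (φ.symm y, s)‖ₑ
            = ENNReal.ofReal (1 / lam) * ENNReal.ofReal lam * ‖u (φ.symm y, s)‖ₑ := by
              rw [← ENNReal.ofReal_mul (by positivity), one_div_mul_cancel hlam.ne',
                ENNReal.ofReal_one, one_mul]
          _ = ENNReal.ofReal (1 / lam) * (‖u (φ.symm y, s)‖ₑ * ENNReal.ofReal lam) := by ring
          _ ≤ ENNReal.ofReal (1 / lam) * (‖u (φ.symm y, s)‖ₑ *
              ENNReal.ofReal (Real.sqrt (chartGramMatrix G₀ x y).det)) :=
              mul_le_mul_right (mul_le_mul_right (ENNReal.ofReal_le_ofReal hρ) _) _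
      · rw [indicator_of_notMem hyK]
        exact zero_le
    calc ∫⁻ y, K.indicator (fun q : (EuclideanSpace ℝ (Fin m) × ℝ) ↦ ‖u (φ.symm q.1, q.2)‖ₑ) (y, s)
        ≤ ∫⁻ y, ENNReal.ofReal (1 / lam) * (φ.target).indicator
            (fun y ↦ F (φ.symm y) * ENNReal.ofReal (Real.sqrt (chartGramMatrix G₀ x y).det)) y :=
          lintegral_mono key
      _ = ENNReal.ofReal (1 / lam) * ∫⁻ y in φ.target,
            F (φ.symm y) * ENNReal.ofReal (Real.sqrt (chartGramMatrix G₀ x y).det) := by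
          rw [lintegral_const_mul' _ _ ENNReal.ofReal_ne_top,
            lintegral_indicator (measurableSet_extChartAt_target x)]
      _ = ENNReal.ofReal (1 / lam) * ∫⁻ p, F p ∂riemannianMeasure G₀ := by
          rw [← lintegral_eq_lintegral_chart G₀ x hFm hFsupp]
  have hAE : AEMeasurable (K.indicator fun q : (EuclideanSpace ℝ (Fin m) × ℝ) ↦ ‖u (φ.symm q.1, q.2)‖ₑ) (volume : Measure (EuclideanSpace ℝ (Fin m) × ℝ)) :=
    (aemeasurable_indicator_iff hKm).2 hmeas.aemeasurable.enorm
  calc ∫⁻ q in K, ‖u (φ.symm q.1, q.2)‖ₑ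
      = ∫⁻ q, K.indicator (fun q : (EuclideanSpace ℝ (Fin m) × ℝ) ↦ ‖u (φ.symm q.1, q.2)‖ₑ) q := (lintegral_indicator hKm _).symm
    _ = ∫⁻ s, ∫⁻ y, K.indicator (fun q : (EuclideanSpace ℝ (Fin m) × ℝ) ↦ ‖u (φ.symm q.1, q.2)‖ₑ) (y, s) := by
        rw [show (volume : Measure (EuclideanSpace ℝ (Fin m) × ℝ)) =
          (volume : Measure (EuclideanSpace ℝ (Fin m))).prod (volume : Measure ℝ) from rfl] at hAE ⊢
        exact lintegral_prod_symm _ hAE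
    _ ≤ ∫⁻ s, ENNReal.ofReal (1 / lam) *
          ∫⁻ p, K'.indicator (fun p : M × ℝ ↦ ‖u p‖ₑ) (p, s) ∂riemannianMeasure G₀ :=
        lintegral_mono hslice
    _ = ENNReal.ofReal (1 / lam) *
          ∫⁻ p, K'.indicator (fun p : M × ℝ ↦ ‖u p‖ₑ) p ∂(riemannianMeasure G₀).prod volume := by
        rw [lintegral_const_mul' _ _ ENNReal.ofReal_ne_top, lintegral_prod_symm]
        exact ((hum.enorm.indicator hK'm).aemeasurable :)
    _ = ENNReal.ofReal (1 / lam) * ∫⁻ p in K', ‖u p‖ₑ ∂(riemannianMeasure G₀).prod volume := by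
        rw [lintegral_indicator hK'm]
    _ < ⊤ := ENNReal.mul_lt_top ENNReal.ofReal_lt_top hfin


variable [I.Boundaryless] [SecondCountableTopology M]
  {h : ℝ → PseudoRiemannianMetric I ∞ (EuclideanSpace ℝ (Fin m)) (TangentSpace I : M → Type _)}

/-- **The very weak heat equation read in a space-time chart** (non-compact `M`). For a family
`h(s)` of Riemannian metrics on `M`, `C^∞` on `M × ℝ`, a Riemannian reference metric `g₀` with
density ratio `ρ = dV_{h(s)}/dV_{g₀}`, `Q, G` smooth on `M × ℝ`, and a measurable `u` with
`∫ u · (−∂ₛ(ρζ) − ρ Δ_{h(s)}ζ + ρQζ) d(V_{g₀} ⊗ ds) = ∫ ρ G ζ d(V_{g₀} ⊗ ds)` for all smooth `ζ`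
compactly supported in `M × T`, the chart representative `ū(y, s) = u(φ⁻¹y, s)` satisfies
`∫ ū · heatTranspose A J q ψ dy ds = ∫ F ψ dy ds` for every smooth `ψ` compactly supported in
`φ.target × T` (`J = √det h(s)ᵢⱼ`, `A = J h(s)⁻¹`, `q = J Q`, `F = J G`): divergence form of the
coordinate Laplacian (`coordLaplacian_mul_sqrt_det_eq_sum_fderiv`, `dalembertian_eq_sum_localFrame`),
chart formula `dV_{g₀} = √det (g₀)ᵢⱼ dy` (`integral_eq_integral_chart`),
`ρ √det (g₀)ᵢⱼ = √det h(s)ᵢⱼ` (`densityRatio_mul_sqrt_det_chartGramMatrix`), Fubini in time.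
[cite: Chavel2006, §III.3 (III.3.6) and §III.7] -/
theorem integral_heatTranspose_chart_of_veryWeak_nc
    (hh : IsContMDiffFamilyOn ∞ h univ) (hR : ∀ s, (h s).IsRiemannian) (hR₀ : g₀.IsRiemannian)
    {Q G : ℝ → M → ℝ} (hQ : ContMDiff (I.prod 𝓘(ℝ, ℝ)) 𝓘(ℝ, ℝ) ∞ fun p : M × ℝ ↦ Q p.2 p.1)
    (hG : ContMDiff (I.prod 𝓘(ℝ, ℝ)) 𝓘(ℝ, ℝ) ∞ fun p : M × ℝ ↦ G p.2 p.1)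
    {T : Set ℝ} (hT : IsOpen T) {u : M × ℝ → ℝ} (hum : Measurable u)
    (hu : LocallyIntegrableOn u (univ ×ˢ T) (g₀.riemVolume.prod (volume : Measure ℝ)))
    (hweak : ∀ ζ : M × ℝ → ℝ, ContMDiff (I.prod 𝓘(ℝ, ℝ)) 𝓘(ℝ, ℝ) ∞ ζ → HasCompactSupport ζ →
      tsupport ζ ⊆ univ ×ˢ T →
      ∫ p, u p * (-(deriv (fun s ↦ (h s).densityRatio g₀ p.1 * ζ (p.1, s)) p.2) -
          (h p.2).densityRatio g₀ p.1 * (h p.2).laplaceBeltrami (fun x ↦ ζ (x, p.2)) p.1 +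
          (h p.2).densityRatio g₀ p.1 * Q p.2 p.1 * ζ p) ∂g₀.riemVolume.prod (volume : Measure ℝ) =
        ∫ p, (h p.2).densityRatio g₀ p.1 * G p.2 p.1 * ζ p ∂g₀.riemVolume.prod (volume : Measure ℝ))
    (x₀ : M) (Jc qc Fc : (EuclideanSpace ℝ (Fin m) × ℝ) → ℝ) (Ac : Fin m → Fin m → (EuclideanSpace ℝ (Fin m) × ℝ) → ℝ)
    (hJc : ∀ q, Jc q = Real.sqrt (chartGramMatrix ((h q.2).toContMDiffRiemannianMetric (hR q.2)) x₀ q.1).det)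
    (hAc : ∀ k l q, Ac k l q =
      Jc q * (chartGramMatrix ((h q.2).toContMDiffRiemannianMetric (hR q.2)) x₀ q.1)⁻¹ k l)
    (hqc : ∀ q, qc q = Jc q * Q q.2 ((extChartAt I x₀).symm q.1))
    (hFc : ∀ q, Fc q = Jc q * G q.2 ((extChartAt I x₀).symm q.1))
    {ψ : (EuclideanSpace ℝ (Fin m) × ℝ) → ℝ} (hψ : ContDiff ℝ ∞ ψ) (hψc : HasCompactSupport ψ)
    (hψT : tsupport ψ ⊆ (extChartAt I x₀).target ×ˢ T) :
    ∫ q, u ((extChartAt I x₀).symm q.1, q.2) * heatTranspose Ac Jc qc ψ q =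
      ∫ q, Fc q * ψ q := by
  classical
  -- notation
  set φ := extChartAt I x₀ with hφ
  set e := trivializationAt (EuclideanSpace ℝ (Fin m)) (TangentSpace I) x₀ with he
  set μ₀ : Measure M := g₀.riemVolume with hμ₀
  have hV : IsOpen φ.target := isOpen_extChartAt_target x₀
  have hO : IsOpen (φ.target ×ˢ (univ : Set ℝ)) := hV.prod isOpen_univ
  haveI : LocallyCompactSpace M := Manifold.locallyCompact_of_finiteDimensional (M := M) I
  haveI : IsFiniteMeasureOnCompacts μ₀ := by
    rw [hμ₀, riemVolume_eq hR₀]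
    exact ⟨fun K hK ↦ riemannianVolume_lt_top_of_isCompact_holds _ le_rfl hK⟩
  have hψT' : tsupport ψ ⊆ φ.target ×ˢ (univ : Set ℝ) := hψT.trans (prod_mono le_rfl (subset_univ _))
  have hsrc : (chartAt H x₀).source = φ.source := (extChartAt_source (I := I) (x := x₀)).symm
  -- the density ratio and its chart identity
  set ρ : M × ℝ → ℝ := fun p ↦ (h p.2).densityRatio g₀ p.1 with hρ
  have hρs : ContMDiff (I.prod 𝓘(ℝ, ℝ)) 𝓘(ℝ, ℝ) ∞ ρ := by
    have h1 := hh.contMDiffOn_densityRatio (fun s _ ↦ hR s) hR₀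
    rw [univ_prod_univ] at h1; exact contMDiffOn_univ.1 h1
  have hρJ : ∀ (y : EuclideanSpace ℝ (Fin m)) (s : ℝ), y ∈ φ.target →
      ρ (φ.symm y, s) * Real.sqrt (chartGramMatrix (g₀.toContMDiffRiemannianMetric hR₀) x₀ y).det =
        Jc (y, s) := by
    intro y s hy; rw [hJc]; exact densityRatio_mul_sqrt_det_chartGramMatrix (hR s) hR₀ x₀ hy
  have hJ0pos : ∀ y ∈ φ.target, 0 < Real.sqrt (chartGramMatrix (g₀.toContMDiffRiemannianMetric hR₀) x₀ y).det :=
    fun y hy ↦ sqrt_det_chartGramMatrix_pos _ x₀ hy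
  -- the Gram family in the chart and the smoothness of the chart data on `φ.target × ℝ`
  set Gh : (EuclideanSpace ℝ (Fin m) × ℝ) → Fin m → Fin m → ℝ := fun q i j ↦
    chartGramMatrix ((h q.2).toContMDiffRiemannianMetric (hR q.2)) x₀ q.1 i j with hGh
  have hofG : ∀ q, Matrix.of (Gh q) = chartGramMatrix ((h q.2).toContMDiffRiemannianMetric (hR q.2)) x₀ q.1 :=
    fun q ↦ by ext i j; rfl
  have hGval : ∀ q ∈ φ.target ×ˢ (univ : Set ℝ), ∀ i j, Gh q i j =
      (h q.2).val (φ.symm q.1) (e.localFrame (EuclideanSpace.basisFun (Fin m) ℝ).toBasis i (φ.symm q.1)) (e.localFrame (EuclideanSpace.basisFun (Fin m) ℝ).toBasis j (φ.symm q.1)) := by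
    intro q hq i j
    exact chartGramMatrix_apply_eq_val_localFrame _ x₀ hq.1 i j
  have hGs : ∀ i j, ContDiffOn ℝ ∞ (fun q ↦ Gh q i j) (φ.target ×ˢ (univ : Set ℝ)) := fun i j ↦
    (hh.contDiffOn_gram_chart x₀ (EuclideanSpace.basisFun (Fin m) ℝ).toBasis i j).congr fun q hq ↦ hGval q hq i j
  have hGsymm : ∀ q i j, Gh q i j = Gh q j i := fun q i j ↦ chartGramMatrix_apply_comm _ x₀ q.1 i j
  have hdetpos : ∀ q ∈ φ.target ×ˢ (univ : Set ℝ), 0 < (Matrix.of (Gh q)).det := fun q hq ↦ by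
    rw [hofG]; exact Real.sqrt_pos.1 (sqrt_det_chartGramMatrix_pos _ x₀ hq.1)
  have hGdet : ContDiffOn ℝ ∞ (fun q ↦ (Matrix.of (Gh q)).det) (φ.target ×ˢ (univ : Set ℝ)) := by
    intro q hq
    have h1 := contMDiffWithinAt_matrix_det (J := 𝓘(ℝ, (EuclideanSpace ℝ (Fin m) × ℝ))) (k := ∞)
      (A := fun q ↦ Matrix.of (Gh q)) (s := φ.target ×ˢ (univ : Set ℝ)) (x₀ := q)
      (fun i j ↦ contMDiffWithinAt_iff_contDiffWithinAt.2 (hGs i j q hq))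
    exact contMDiffWithinAt_iff_contDiffWithinAt.1 h1
  have hJcs : ContDiffOn ℝ ∞ Jc (φ.target ×ˢ (univ : Set ℝ)) := by
    have : Jc = fun q ↦ Real.sqrt (Matrix.of (Gh q)).det := funext fun q ↦ by rw [hJc, hofG]
    rw [this]; exact hGdet.sqrt fun q hq ↦ (hdetpos q hq).ne'
  have hGinv : ∀ i l, ContDiffOn ℝ ∞ (fun q ↦ (Matrix.of (Gh q))⁻¹ i l) (φ.target ×ˢ (univ : Set ℝ)) := by
    intro i l q hq
    have h1 := contMDiffWithinAt_matrix_inv (J := 𝓘(ℝ, (EuclideanSpace ℝ (Fin m) × ℝ))) (k := ∞)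
      (A := fun q ↦ Matrix.of (Gh q)) (s := φ.target ×ˢ (univ : Set ℝ)) (x₀ := q)
      (fun i j ↦ contMDiffWithinAt_iff_contDiffWithinAt.2 (hGs i j q hq)) (hdetpos q hq).ne' i l
    exact contMDiffWithinAt_iff_contDiffWithinAt.1 h1
  have hAcs : ∀ k l, ContDiffOn ℝ ∞ (Ac k l) (φ.target ×ˢ (univ : Set ℝ)) := fun k l ↦ by
    have : Ac k l = fun q ↦ Jc q * (Matrix.of (Gh q))⁻¹ k l := funext fun q ↦ by rw [hAc, hofG]
    rw [this]; exact hJcs.mul (hGinv k l)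
  have hQch : ContDiffOn ℝ ∞ (fun q : (EuclideanSpace ℝ (Fin m) × ℝ) ↦ Q q.2 (φ.symm q.1)) (φ.target ×ˢ (univ : Set ℝ)) :=
    contDiffOn_time_chart (k := (⊤ : ℕ∞)) hQ.contMDiffOn x₀
  have hGch : ContDiffOn ℝ ∞ (fun q : (EuclideanSpace ℝ (Fin m) × ℝ) ↦ G q.2 (φ.symm q.1)) (φ.target ×ˢ (univ : Set ℝ)) :=
    contDiffOn_time_chart (k := (⊤ : ℕ∞)) hG.contMDiffOn x₀
  have hqcs : ContDiffOn ℝ ∞ qc (φ.target ×ˢ (univ : Set ℝ)) := by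
    rw [show qc = fun q ↦ Jc q * Q q.2 (φ.symm q.1) from funext hqc]; exact hJcs.mul hQch
  -- the test function on `M × ℝ`
  obtain ⟨ζ, hζdef⟩ : ∃ ζ : M × ℝ → ℝ, ζ = ((chartAt H x₀).source ×ˢ (univ : Set ℝ)).indicator
      fun p : M × ℝ ↦ ψ (extChartAt I x₀ p.1, p.2) := ⟨_, rfl⟩
  have hζs : ContMDiff (I.prod 𝓘(ℝ, ℝ)) 𝓘(ℝ, ℝ) ∞ ζ :=
    hζdef ▸ contMDiff_indicator_comp_extChartAt_prod x₀ hψ hψc hψT'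
  have hζc : HasCompactSupport ζ := hζdef ▸ hasCompactSupport_indicator_comp_extChartAt_prod x₀ hψc hψT'
  have hζT : tsupport ζ ⊆ univ ×ˢ T :=
    hζdef ▸ tsupport_indicator_comp_extChartAt_prod_subset_time x₀ hψc hψT
  obtain ⟨hts, hKc, hKS⟩ := tsupport_indicator_comp_extChartAt_prod_subset (I := I) x₀ hψc hψT'
  have hζsupp : tsupport ζ ⊆ φ.source ×ˢ (univ : Set ℝ) := by rw [hζdef, ← hsrc]; exact hts.trans hKS
  have hζψ : ∀ (y : EuclideanSpace ℝ (Fin m)) (s : ℝ), y ∈ φ.target → ζ (φ.symm y, s) = ψ (y, s) := by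
    intro y s hy; rw [hζdef]; exact indicator_comp_extChartAt_prod_symm_apply x₀ ψ hy s
  -- the weak identity for `ζ`
  have hW := hweak ζ hζs hζc hζT
  -- abbreviations for the manifold-side integrands
  set Tζ : M × ℝ → ℝ := fun p ↦ -(deriv (fun s ↦ (h s).densityRatio g₀ p.1 * ζ (p.1, s)) p.2) -
      (h p.2).densityRatio g₀ p.1 * (h p.2).laplaceBeltrami (fun x ↦ ζ (x, p.2)) p.1 +
      (h p.2).densityRatio g₀ p.1 * Q p.2 p.1 * ζ p with hTζ
  set Rζ : M × ℝ → ℝ := fun p ↦ (h p.2).densityRatio g₀ p.1 * G p.2 p.1 * ζ p with hRζ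
  -- smoothness of the manifold-side integrands
  have hρζ : ContMDiff (I.prod 𝓘(ℝ, ℝ)) 𝓘(ℝ, ℝ) ∞ fun p : M × ℝ ↦ ρ p * ζ p := hρs.mul hζs
  have hDt : ContMDiff (I.prod 𝓘(ℝ, ℝ)) 𝓘(ℝ, ℝ) ∞
      fun p : M × ℝ ↦ deriv (fun s ↦ (h s).densityRatio g₀ p.1 * ζ (p.1, s)) p.2 := by
    have h1 := contMDiffOn_derivWithin_time_of_uniqueDiffOn (I := I) (M := M)
      (u := fun s x ↦ (h s).densityRatio g₀ x * ζ (x, s)) (S := univ) uniqueDiffOn_univ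
      (by rw [univ_prod_univ]; exact hρζ.contMDiffOn)
    rw [univ_prod_univ] at h1
    simpa only [derivWithin_univ] using contMDiffOn_univ.1 h1
  have hΔ : ContMDiff (I.prod 𝓘(ℝ, ℝ)) 𝓘(ℝ, ℝ) ∞
      fun p : M × ℝ ↦ (h p.2).laplaceBeltrami (fun x ↦ ζ (x, p.2)) p.1 := by
    have h1 := hh.contMDiffOn_laplaceBeltrami uniqueDiffOn_univ (f := fun s x ↦ ζ (x, s))
      (by rw [univ_prod_univ]; exact hζs.contMDiffOn)
    rw [univ_prod_univ] at h1; exact contMDiffOn_univ.1 h1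
  have hTζs : ContMDiff (I.prod 𝓘(ℝ, ℝ)) 𝓘(ℝ, ℝ) ∞ Tζ :=
    (hDt.neg.sub (hρs.mul hΔ)).add ((hρs.mul hQ).mul hζs)
  have hRζs : ContMDiff (I.prod 𝓘(ℝ, ℝ)) 𝓘(ℝ, ℝ) ∞ Rζ := (hρs.mul hG).mul hζs
  -- both vanish off `tsupport ζ`
  have hslice0 : ∀ p : M × ℝ, p ∉ tsupport ζ → p.1 ∉ tsupport (fun x ↦ ζ (x, p.2)) := by
    rintro ⟨x, s⟩ hp hx
    have hev : ζ =ᶠ[𝓝 (x, s)] 0 := notMem_tsupport_iff_eventuallyEq.1 hp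
    have : (fun x' ↦ ζ (x', s)) =ᶠ[𝓝 x] 0 := by
      exact (show ContinuousAt (fun x' : M ↦ ((x', s) : M × ℝ)) x by fun_prop).eventually hev
    exact (notMem_tsupport_iff_eventuallyEq.2 this) hx
  have hT0 : ∀ p ∉ tsupport ζ, Tζ p = 0 := by
    rintro ⟨x, s⟩ hp
    have hev : ζ =ᶠ[𝓝 (x, s)] 0 := notMem_tsupport_iff_eventuallyEq.1 hp
    have hd : deriv (fun s' ↦ (h s').densityRatio g₀ x * ζ (x, s')) s = 0 := by
      have hc : ContinuousAt (fun s' : ℝ ↦ ((x, s') : M × ℝ)) s := by fun_prop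
      have h1 : (fun s' ↦ (h s').densityRatio g₀ x * ζ (x, s')) =ᶠ[𝓝 s] fun _ ↦ 0 := by
        filter_upwards [hc.eventually hev] with s' hs'
        rw [hs', Pi.zero_apply, mul_zero]
      rw [h1.deriv_eq]; exact deriv_const s 0
    haveI := (h s).hasLeviCivita
    have hΔ0 : (h s).laplaceBeltrami (fun x' ↦ ζ (x', s)) x = 0 := by
      rw [laplaceBeltrami_eq_dalembertian]
      exact dalembertian_eq_zero_of_notMem_tsupport _ (hslice0 (x, s) hp)
    have hζ0 : ζ (x, s) = 0 := image_eq_zero_of_notMem_tsupport hp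
    simp only [hTζ, hd, hΔ0, hζ0, mul_zero, neg_zero, sub_zero, add_zero]
  have hR0 : ∀ p ∉ tsupport ζ, Rζ p = 0 := fun p hp ↦ by simp only [hRζ, image_eq_zero_of_notMem_tsupport hp, mul_zero]
  -- integrability on `M × ℝ` and Fubini
  have hTζsupp : tsupport Tζ ⊆ tsupport ζ :=
    closure_minimal (fun p hp ↦ by_contra fun h' ↦ hp (hT0 p h')) (isClosed_tsupport ζ)
  have hRζsupp : tsupport Rζ ⊆ tsupport ζ :=
    closure_minimal (fun p hp ↦ by_contra fun h' ↦ hp (hR0 p h')) (isClosed_tsupport ζ)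
  have hTζc : HasCompactSupport Tζ := hζc.of_isClosed_subset (isClosed_tsupport _) hTζsupp
  have hRζc : HasCompactSupport Rζ := hζc.of_isClosed_subset (isClosed_tsupport _) hRζsupp
  have hint : Integrable (fun p ↦ u p * Tζ p) (μ₀.prod (volume : Measure ℝ)) :=
    integrable_mul_of_locallyIntegrableOn hu hTζs.continuous hTζc (hTζsupp.trans hζT)
  -- local integrability of the chart representative
  have hū : LocallyIntegrableOn (fun q : (EuclideanSpace ℝ (Fin m) × ℝ) ↦ u (φ.symm q.1, q.2)) (φ.target ×ˢ T)
      (volume : Measure (EuclideanSpace ℝ (Fin m) × ℝ)) := locallyIntegrableOn_comp_chart_prod_nc hR₀ x₀ hT hum hu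
  -- the chart-side transpose is smooth with compact support in `tsupport ψ`
  obtain ⟨hHs, hHc, hHsupp⟩ := heatTranspose_contDiff_of_tsupport hO hAcs hJcs hqcs hψ hψc hψT'
  -- (1) the slice identity for the left-hand side
  have hLslice : ∀ s : ℝ, ∫ x, u (x, s) * Tζ (x, s) ∂μ₀ =
      ∫ y, u (φ.symm y, s) * heatTranspose Ac Jc qc ψ (y, s) := by
    intro s
    -- the integrand on `M` is supported in the chart domain
    have hmeas : Measurable fun x ↦ u (x, s) * Tζ (x, s) :=
      (hum.comp (measurable_id.prodMk measurable_const)).mul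
        (hTζs.continuous.comp (continuous_id.prodMk continuous_const)).measurable
    have hsupp : support (fun x ↦ u (x, s) * Tζ (x, s)) ⊆ φ.source := by
      intro x hx
      rw [mem_support] at hx
      have hx' : Tζ (x, s) ≠ 0 := right_ne_zero_of_mul hx
      have : (x, s) ∈ tsupport ζ := by_contra fun h' ↦ hx' (hT0 _ h')
      exact (hζsupp this).1
    rw [hμ₀, riemVolume_eq hR₀, integral_eq_integral_chart _ x₀ hmeas hsupp]
    -- pointwise identity on the target
    have hpt : ∀ y ∈ φ.target,
        Real.sqrt (chartGramMatrix (g₀.toContMDiffRiemannianMetric hR₀) x₀ y).det •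
          (u (φ.symm y, s) * Tζ (φ.symm y, s)) =
        u (φ.symm y, s) * heatTranspose Ac Jc qc ψ (y, s) := by
      intro y hy
      have hq : ((y, s) : (EuclideanSpace ℝ (Fin m) × ℝ)) ∈ φ.target ×ˢ (univ : Set ℝ) := ⟨hy, mem_univ _⟩
      have hyx : φ.symm y ∈ (chartAt H x₀).source := by rw [hsrc]; exact φ.map_target hy
      set J0 : ℝ := Real.sqrt (chartGramMatrix (g₀.toContMDiffRiemannianMetric hR₀) x₀ y).det
        with hJ0
      have hJ0p : 0 < J0 := hJ0pos y hy
      -- (a) the time-derivative term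
      have ha : J0 * deriv (fun s' ↦ (h s').densityRatio g₀ (φ.symm y) * ζ (φ.symm y, s')) s =
          fderiv ℝ (fun z ↦ Jc z * ψ z) (y, s) ((0 : EuclideanSpace ℝ (Fin m)), (1 : ℝ)) := by
        have hfun : (fun s' ↦ (h s').densityRatio g₀ (φ.symm y) * ζ (φ.symm y, s')) =
            fun s' ↦ J0⁻¹ * (Jc (y, s') * ψ (y, s')) := by
          funext s'
          have h1 := hρJ y s' hy
          simp only [hρ] at h1
          rw [hζψ y s' hy, ← h1, hJ0]
          have hne : Real.sqrt (chartGramMatrix (g₀.toContMDiffRiemannianMetric hR₀) x₀ y).det ≠ 0 :=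
            (hJ0pos y hy).ne'
          field_simp
        rw [hfun, deriv_const_mul_field', ← mul_assoc, mul_inv_cancel₀ hJ0p.ne', one_mul]
        exact deriv_slice_right (((hJcs.mul hψ.contDiffOn).contDiffAt (hO.mem_nhds hq)).differentiableAt
          (by simp))
      -- (b) the Laplacian term
      have hb : J0 * ((h s).densityRatio g₀ (φ.symm y) *
          (h s).laplaceBeltrami (fun x ↦ ζ (x, s)) (φ.symm y)) =
          ∑ k, fderiv ℝ (fun z ↦ ∑ l, Ac k l z * fderiv ℝ ψ z ((EuclideanSpace.basisFun (Fin m) ℝ).toBasis l, 0)) (y, s) ((EuclideanSpace.basisFun (Fin m) ℝ).toBasis k, 0) := by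
        -- the slice functions in the chart
        set Ghs : EuclideanSpace ℝ (Fin m) → Fin m → Fin m → ℝ := fun z i j ↦ Gh (z, s) i j with hGhs
        set ψs : EuclideanSpace ℝ (Fin m) → ℝ := fun z ↦ ψ (z, s) with hψs
        have hψss : ContDiff ℝ ∞ ψs := hψ.comp (contDiff_id.prodMk contDiff_const)
        have hψs2 : ContDiff ℝ 2 ψs := hψss.of_le (by norm_cast)
        have hGhs_s : ∀ i j, ContDiffOn ℝ ∞ (fun z ↦ Ghs z i j) φ.target := fun i j ↦
          (hGs i j).comp (contDiffOn_id.prodMk contDiffOn_const) fun z hz ↦ ⟨hz, mem_univ _⟩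
        have hGhs_pi : ContDiffOn ℝ ∞ Ghs φ.target :=
          contDiffOn_pi.2 fun i ↦ contDiffOn_pi.2 fun j ↦ hGhs_s i j
        have hGy : HasFDerivAt Ghs (fderiv ℝ Ghs y) y :=
          ((hGhs_pi.contDiffAt (hV.mem_nhds hy)).differentiableAt (by simp)).hasFDerivAt
        have hf2y : HasFDerivAt (fun z ↦ fderiv ℝ ψs z) (fderiv ℝ (fderiv ℝ ψs) y) y :=
          (((hψs2.fderiv_right (m := 1) (by norm_num)).contDiffAt).differentiableAt
            one_ne_zero).hasFDerivAt
        have hζslice : CMDiff ∞ (fun x ↦ ζ (x, s)) := hζs.comp (contMDiff_id.prodMk contMDiff_const)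
        have hζ2 : CMDiffAt 2 (fun x ↦ ζ (x, s)) (φ.symm y) := (hζslice.of_le (by norm_cast)) _
        haveI := (h s).hasLeviCivita
        have hL := dalembertian_eq_sum_localFrame (h s) (EuclideanSpace.basisFun (Fin m) ℝ).toBasis hyx hζ2 (Gh := Ghs) (fh := ψs) (by
            rw [φ.right_inv hy]
            filter_upwards [hV.mem_nhds hy] with z hz
            intro i j
            exact hGval (z, s) ⟨hz, mem_univ _⟩ i j) (by
            rw [φ.right_inv hy]
            filter_upwards [hV.mem_nhds hy] with z hz
            simp only [hψs, Function.comp_apply]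
            exact (hζψ z s hz).symm)
        rw [φ.right_inv hy] at hL
        have hdety : 0 < (Matrix.of (Ghs y)).det := hdetpos (y, s) hq
        have hGsymm' : ∀ z i j, Ghs z i j = Ghs z j i := fun z i j ↦ hGsymm (z, s) i j
        have hC := Literature.Analysis.Calculus.coordLaplacian_mul_sqrt_det_eq_sum_fderiv (EuclideanSpace.basisFun (Fin m) ℝ).toBasis hGy
          hGsymm' hdety hf2y
        rw [(h s).laplaceBeltrami_eq_dalembertian, hL]
        simp only [Literature.Analysis.Calculus.fderiv_apply_apply_eq hGy] at hC ⊢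
        -- `J0 * ρ = Jc (y, s) = √det (Ghs y)`
        have hJρ : J0 * (h s).densityRatio g₀ (φ.symm y) = Real.sqrt (Matrix.of (Ghs y)).det := by
          rw [mul_comm]
          have := hρJ y s hy
          simp only [hρ] at this
          rw [this, hJc, hofG]
        rw [← mul_assoc, hJρ, hC]
        -- convert slice derivatives to space-time derivatives
        refine Finset.sum_congr rfl fun k _ ↦ ?_
        have hWk : ContDiffOn ℝ ∞ (fun z ↦ ∑ l, Ac k l z * fderiv ℝ ψ z ((EuclideanSpace.basisFun (Fin m) ℝ).toBasis l, 0))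
            (φ.target ×ˢ (univ : Set ℝ)) :=
          ContDiffOn.sum fun l _ ↦ (hAcs k l).mul
            ((hψ.fderiv_right (m := ∞) (by exact_mod_cast le_top)).clm_apply contDiff_const).contDiffOn
        have hev : (fun z ↦ Real.sqrt (Matrix.of (Ghs z)).det *
            ∑ l, (Matrix.of (Ghs z))⁻¹ k l * fderiv ℝ ψs z ((EuclideanSpace.basisFun (Fin m) ℝ).toBasis l)) =ᶠ[𝓝 y]
            fun z ↦ ∑ l, Ac k l (z, s) * fderiv ℝ ψ (z, s) ((EuclideanSpace.basisFun (Fin m) ℝ).toBasis l, 0) := by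
          filter_upwards [hV.mem_nhds hy] with z hz
          rw [Finset.mul_sum]
          refine Finset.sum_congr rfl fun l _ ↦ ?_
          rw [hAc, hJc, hofG, fderiv_slice_left (hψ.differentiable (by simp) _) ((EuclideanSpace.basisFun (Fin m) ℝ).toBasis l), mul_assoc]
        rw [hev.fderiv_eq]
        exact fderiv_slice_left ((hWk.contDiffAt (hO.mem_nhds hq)).differentiableAt (by simp)) ((EuclideanSpace.basisFun (Fin m) ℝ).toBasis k)
      -- (c) the potential term
      have hc : J0 * ((h s).densityRatio g₀ (φ.symm y) * Q s (φ.symm y) * ζ (φ.symm y, s)) =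
          qc (y, s) * ψ (y, s) := by
        rw [hqc, hζψ y s hy, ← hρJ y s hy]
        simp only [hρ]
        ring
      -- assemble
      rw [heatTranspose_apply, smul_eq_mul]
      simp only [hTζ]
      have : J0 * (-(deriv (fun s' ↦ (h s').densityRatio g₀ (φ.symm y) * ζ (φ.symm y, s')) s) -
          (h s).densityRatio g₀ (φ.symm y) * (h s).laplaceBeltrami (fun x ↦ ζ (x, s)) (φ.symm y) +
          (h s).densityRatio g₀ (φ.symm y) * Q s (φ.symm y) * ζ (φ.symm y, s)) =
          -(J0 * deriv (fun s' ↦ (h s').densityRatio g₀ (φ.symm y) * ζ (φ.symm y, s')) s) -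
            J0 * ((h s).densityRatio g₀ (φ.symm y) *
              (h s).laplaceBeltrami (fun x ↦ ζ (x, s)) (φ.symm y)) +
            J0 * ((h s).densityRatio g₀ (φ.symm y) * Q s (φ.symm y) * ζ (φ.symm y, s)) := by ring
      rw [mul_left_comm, this, ha, hb, hc]
    rw [setIntegral_congr_fun (measurableSet_extChartAt_target x₀) hpt,
      setIntegral_eq_integral_of_forall_compl_eq_zero]
    intro y hy
    have : ((y, s) : (EuclideanSpace ℝ (Fin m) × ℝ)) ∉ tsupport ψ := fun h' ↦ hy (hψT' h').1
    rw [heatTranspose_eq_zero_of_notMem_tsupport this, mul_zero]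
  -- (2) the slice identity for the right-hand side
  have hRslice : ∀ s : ℝ, ∫ x, Rζ (x, s) ∂μ₀ = ∫ y, Fc (y, s) * ψ (y, s) := by
    intro s
    have hmeas : Measurable fun x ↦ Rζ (x, s) :=
      (hRζs.continuous.comp (continuous_id.prodMk continuous_const)).measurable
    have hsupp : support (fun x ↦ Rζ (x, s)) ⊆ φ.source := by
      intro x hx
      rw [mem_support] at hx
      have : (x, s) ∈ tsupport ζ := by_contra fun h' ↦ hx (hR0 _ h')
      exact (hζsupp this).1
    rw [hμ₀, riemVolume_eq hR₀, integral_eq_integral_chart _ x₀ hmeas hsupp]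
    have hpt : ∀ y ∈ φ.target,
        Real.sqrt (chartGramMatrix (g₀.toContMDiffRiemannianMetric hR₀) x₀ y).det • Rζ (φ.symm y, s) =
        Fc (y, s) * ψ (y, s) := by
      intro y hy
      have h1 := hρJ y s hy
      simp only [hρ] at h1
      simp only [hRζ, smul_eq_mul]
      rw [hζψ y s hy, hFc, ← h1]
      ring
    rw [setIntegral_congr_fun (measurableSet_extChartAt_target x₀) hpt,
      setIntegral_eq_integral_of_forall_compl_eq_zero]
    intro y hy
    have : ((y, s) : (EuclideanSpace ℝ (Fin m) × ℝ)) ∉ tsupport ψ := fun h' ↦ hy (hψT' h').1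
    rw [image_eq_zero_of_notMem_tsupport this, mul_zero]
  -- (3) Fubini on both sides
  have hLHS : ∫ p, u p * Tζ p ∂μ₀.prod (volume : Measure ℝ) =
      ∫ q, u (φ.symm q.1, q.2) * heatTranspose Ac Jc qc ψ q := by
    rw [integral_prod_symm _ hint]
    simp_rw [hLslice]
    have hint' : Integrable (fun q : (EuclideanSpace ℝ (Fin m) × ℝ) ↦ u (φ.symm q.1, q.2) * heatTranspose Ac Jc qc ψ q)
        (volume : Measure (EuclideanSpace ℝ (Fin m) × ℝ)) :=
      integrable_mul_of_locallyIntegrableOn hū hHs.continuous hHc (hHsupp.trans hψT)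
    rw [show (volume : Measure (EuclideanSpace ℝ (Fin m) × ℝ)) = (volume : Measure (EuclideanSpace ℝ (Fin m))).prod
      (volume : Measure ℝ) from rfl] at hint' ⊢
    rw [integral_prod_symm _ hint']
  have hRHS : ∫ p, Rζ p ∂μ₀.prod (volume : Measure ℝ) = ∫ q, Fc q * ψ q := by
    have hintR : Integrable Rζ (μ₀.prod (volume : Measure ℝ)) :=
      hRζs.continuous.integrable_of_hasCompactSupport hRζc
    rw [integral_prod_symm _ hintR]
    simp_rw [hRslice]
    have hFcs : ContDiffOn ℝ ∞ Fc (φ.target ×ˢ (univ : Set ℝ)) := by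
      rw [show Fc = fun q ↦ Jc q * G q.2 (φ.symm q.1) from funext hFc]; exact hJcs.mul hGch
    have hFψ : ContDiff ℝ ∞ fun q ↦ Fc q * ψ q :=
      contDiff_of_contDiffOn_of_eq_zero hO hψc hψT' (hFcs.mul hψ.contDiffOn)
        fun q hq ↦ by rw [image_eq_zero_of_notMem_tsupport hq, mul_zero]
    have hFψc : HasCompactSupport fun q ↦ Fc q * ψ q := hψc.mul_left
    have hint' : Integrable (fun q : (EuclideanSpace ℝ (Fin m) × ℝ) ↦ Fc q * ψ q) (volume : Measure (EuclideanSpace ℝ (Fin m) × ℝ)) :=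
      hFψ.continuous.integrable_of_hasCompactSupport hFψc
    rw [show (volume : Measure (EuclideanSpace ℝ (Fin m) × ℝ)) = (volume : Measure (EuclideanSpace ℝ (Fin m))).prod
      (volume : Measure ℝ) from rfl] at hint' ⊢
    rw [integral_prod_symm _ hint']
  rw [← hLHS, ← hRHS]
  exact hW


/-- **Interior regularity of very weak solutions of the linear heat equation on a (possibly
non-compact) manifold.** Let `h(s)` be a family of Riemannian metrics on the `T3`, second-countable
manifold `M` (modelled on `ℝᵐ`), `C^∞` on `M × ℝ`, `g₀` a Riemannian reference metric with density ratio
`ρ = dV_{h(s)}/dV_{g₀}`, `Q, G` smooth on `M × ℝ`, `T ⊆ ℝ` open, and let the measurable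
`u : M × ℝ → ℝ`, locally integrable on `M × T` for `dV_{g₀} ⊗ ds`, satisfy
`∫ u · (−∂ₛ(ρζ) − ρ Δ_{h(s)}ζ + ρQζ) = ∫ ρ G ζ` for all smooth `ζ` compactly supported in
`M × T` — the very weak form of **`∂ₛu = Δ_{h(s)}u − Qu + G`**. Then `u` agrees a.e. on `M × T`
with a function `C^∞` on `M × T`. Proof: in each space-time chart the representative is a very
weak solution of a parabolic equation with smooth coefficients
(`integral_heatTranspose_chart_of_veryWeak_nc`), hence locally a.e. smooth by Hörmander's theorem
(`exists_contDiffOn_ae_eq_of_heat_veryWeak`, from `hormander1967_thm11_proof`); the local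
representatives are pulled back (`ae_prod_chart_of_ae_volume_nc`) and patched
(`exists_contMDiffOn_ae_eq_of_forall_exists_nhds`). [cite: Hormander1967, Thm 1.1 and p. 147] -/
theorem exists_contMDiffOn_ae_eq_of_linearHeat_veryWeak_nc
    (hh : IsContMDiffFamilyOn ∞ h univ) (hR : ∀ s, (h s).IsRiemannian) (hR₀ : g₀.IsRiemannian)
    {Q G : ℝ → M → ℝ} (hQ : ContMDiff (I.prod 𝓘(ℝ, ℝ)) 𝓘(ℝ, ℝ) ∞ fun p : M × ℝ ↦ Q p.2 p.1)
    (hG : ContMDiff (I.prod 𝓘(ℝ, ℝ)) 𝓘(ℝ, ℝ) ∞ fun p : M × ℝ ↦ G p.2 p.1)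
    {T : Set ℝ} (hT : IsOpen T) {u : M × ℝ → ℝ} (hum : Measurable u)
    (hu : LocallyIntegrableOn u (univ ×ˢ T) (g₀.riemVolume.prod (volume : Measure ℝ)))
    (hweak : ∀ ζ : M × ℝ → ℝ, ContMDiff (I.prod 𝓘(ℝ, ℝ)) 𝓘(ℝ, ℝ) ∞ ζ → HasCompactSupport ζ →
      tsupport ζ ⊆ univ ×ˢ T →
      ∫ p, u p * (-(deriv (fun s ↦ (h s).densityRatio g₀ p.1 * ζ (p.1, s)) p.2) -
          (h p.2).densityRatio g₀ p.1 * (h p.2).laplaceBeltrami (fun x ↦ ζ (x, p.2)) p.1 +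
          (h p.2).densityRatio g₀ p.1 * Q p.2 p.1 * ζ p) ∂g₀.riemVolume.prod (volume : Measure ℝ) =
        ∫ p, (h p.2).densityRatio g₀ p.1 * G p.2 p.1 * ζ p ∂g₀.riemVolume.prod (volume : Measure ℝ)) :
    ∃ v : M × ℝ → ℝ, ContMDiffOn (I.prod 𝓘(ℝ, ℝ)) 𝓘(ℝ, ℝ) ∞ v (univ ×ˢ T) ∧
      ∀ᵐ p ∂g₀.riemVolume.prod (volume : Measure ℝ), p ∈ univ ×ˢ T → u p = v p := by
  classical
  set μ₀ : Measure M := g₀.riemVolume with hμ₀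
  haveI : μ₀.IsOpenPosMeasure := by
    rw [hμ₀, riemVolume_eq hR₀]; exact isOpenPosMeasure_riemannianMeasure _
  haveI : (μ₀.prod (volume : Measure ℝ)).IsOpenPosMeasure := prod.instIsOpenPosMeasure
  refine exists_contMDiffOn_ae_eq_of_forall_exists_nhds (JX := I.prod 𝓘(ℝ, ℝ))
    (μ := μ₀.prod (volume : Measure ℝ)) fun p₀ hp₀ ↦ ?_
  obtain ⟨x₀, s₀⟩ := p₀
  have hs₀ : s₀ ∈ T := hp₀.2
  set φ := extChartAt I x₀ with hφ
  have hV : IsOpen φ.target := isOpen_extChartAt_target x₀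
  have hO : IsOpen (φ.target ×ˢ (univ : Set ℝ)) := hV.prod isOpen_univ
  have hΩ : IsOpen (φ.target ×ˢ T) := hV.prod hT
  have hΩO : φ.target ×ˢ T ⊆ φ.target ×ˢ (univ : Set ℝ) := prod_mono le_rfl (subset_univ _)
  -- the chart data
  set Jc : (EuclideanSpace ℝ (Fin m) × ℝ) → ℝ := fun q ↦
    Real.sqrt (chartGramMatrix ((h q.2).toContMDiffRiemannianMetric (hR q.2)) x₀ q.1).det with hJc
  set Ac : Fin m → Fin m → (EuclideanSpace ℝ (Fin m) × ℝ) → ℝ := fun k l q ↦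
    Jc q * (chartGramMatrix ((h q.2).toContMDiffRiemannianMetric (hR q.2)) x₀ q.1)⁻¹ k l with hAc
  set qc : (EuclideanSpace ℝ (Fin m) × ℝ) → ℝ := fun q ↦ Jc q * Q q.2 (φ.symm q.1) with hqc
  set Fc : (EuclideanSpace ℝ (Fin m) × ℝ) → ℝ := fun q ↦ Jc q * G q.2 (φ.symm q.1) with hFc
  -- smoothness of the chart data (as in the chart identity)
  set e := trivializationAt (EuclideanSpace ℝ (Fin m)) (TangentSpace I) x₀ with he
  set Gh : (EuclideanSpace ℝ (Fin m) × ℝ) → Fin m → Fin m → ℝ := fun q i j ↦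
    chartGramMatrix ((h q.2).toContMDiffRiemannianMetric (hR q.2)) x₀ q.1 i j with hGh
  have hofG : ∀ q, Matrix.of (Gh q) =
      chartGramMatrix ((h q.2).toContMDiffRiemannianMetric (hR q.2)) x₀ q.1 := fun q ↦ by ext i j; rfl
  have hGs : ∀ i j, ContDiffOn ℝ ∞ (fun q ↦ Gh q i j) (φ.target ×ˢ (univ : Set ℝ)) := fun i j ↦
    (hh.contDiffOn_gram_chart x₀ (EuclideanSpace.basisFun (Fin m) ℝ).toBasis i j).congr fun q hq ↦
      chartGramMatrix_apply_eq_val_localFrame _ x₀ hq.1 i j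
  have hdetpos : ∀ q ∈ φ.target ×ˢ (univ : Set ℝ), 0 < (Matrix.of (Gh q)).det := fun q hq ↦ by
    rw [hofG]; exact Real.sqrt_pos.1 (sqrt_det_chartGramMatrix_pos _ x₀ hq.1)
  have hGdet : ContDiffOn ℝ ∞ (fun q ↦ (Matrix.of (Gh q)).det) (φ.target ×ˢ (univ : Set ℝ)) := by
    intro q hq
    have h1 := contMDiffWithinAt_matrix_det (J := 𝓘(ℝ, (EuclideanSpace ℝ (Fin m) × ℝ))) (k := ∞)
      (A := fun q ↦ Matrix.of (Gh q)) (s := φ.target ×ˢ (univ : Set ℝ)) (x₀ := q)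
      (fun i j ↦ contMDiffWithinAt_iff_contDiffWithinAt.2 (hGs i j q hq))
    exact contMDiffWithinAt_iff_contDiffWithinAt.1 h1
  have hJcs : ContDiffOn ℝ ∞ Jc (φ.target ×ˢ (univ : Set ℝ)) := by
    have : Jc = fun q ↦ Real.sqrt (Matrix.of (Gh q)).det := funext fun q ↦ by rw [hJc, hofG]
    rw [this]
    exact hGdet.sqrt fun q hq ↦ (hdetpos q hq).ne'
  have hGinv : ∀ i l, ContDiffOn ℝ ∞ (fun q ↦ (Matrix.of (Gh q))⁻¹ i l) (φ.target ×ˢ (univ : Set ℝ)) := by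
    intro i l q hq
    have h1 := contMDiffWithinAt_matrix_inv (J := 𝓘(ℝ, (EuclideanSpace ℝ (Fin m) × ℝ))) (k := ∞)
      (A := fun q ↦ Matrix.of (Gh q)) (s := φ.target ×ˢ (univ : Set ℝ)) (x₀ := q)
      (fun i j ↦ contMDiffWithinAt_iff_contDiffWithinAt.2 (hGs i j q hq)) (hdetpos q hq).ne' i l
    exact contMDiffWithinAt_iff_contDiffWithinAt.1 h1
  have hAcs : ∀ k l, ContDiffOn ℝ ∞ (Ac k l) (φ.target ×ˢ (univ : Set ℝ)) := by
    intro k l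
    have : Ac k l = fun q ↦ Jc q * (Matrix.of (Gh q))⁻¹ k l := funext fun q ↦ by rw [hAc, hofG]
    rw [this]; exact hJcs.mul (hGinv k l)
  have hqcs : ContDiffOn ℝ ∞ qc (φ.target ×ˢ (univ : Set ℝ)) :=
    hJcs.mul (contDiffOn_time_chart (k := (⊤ : ℕ∞)) hQ.contMDiffOn x₀)
  have hFcs : ContDiffOn ℝ ∞ Fc (φ.target ×ˢ (univ : Set ℝ)) :=
    hJcs.mul (contDiffOn_time_chart (k := (⊤ : ℕ∞)) hG.contMDiffOn x₀)
  -- symmetry and positivity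
  have hAsymm : ∀ k l q, Ac k l q = Ac l k q := by
    intro k l q
    simp only [hAc]
    congr 1
    have hsym : (chartGramMatrix ((h q.2).toContMDiffRiemannianMetric (hR q.2)) x₀ q.1).IsSymm :=
      Matrix.IsSymm.ext fun i j ↦ chartGramMatrix_apply_comm _ x₀ q.1 j i
    exact (hsym.inv.apply k l).symm
  have hApos : ∀ q ∈ φ.target ×ˢ T, ∀ v : Fin m → ℝ, v ≠ 0 →
      0 < ∑ k, ∑ l, Ac k l q * (v k * v l) :=
    fun q hq v hv ↦ heatCoeff_chart_pos (hR q.2) x₀ hq.1 v hv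
  have hJpos : ∀ q ∈ φ.target ×ˢ T, 0 < Jc q := fun q hq ↦ sqrt_det_chartGramMatrix_pos _ x₀ hq.1
  -- local integrability of the representative and the chart identity
  have hū : LocallyIntegrableOn (fun q : (EuclideanSpace ℝ (Fin m) × ℝ) ↦ u (φ.symm q.1, q.2)) (φ.target ×ˢ T)
      (volume : Measure (EuclideanSpace ℝ (Fin m) × ℝ)) := locallyIntegrableOn_comp_chart_prod_nc hR₀ x₀ hT hum hu
  have hchart : ∀ ψ : (EuclideanSpace ℝ (Fin m) × ℝ) → ℝ, ContDiff ℝ ∞ ψ → HasCompactSupport ψ → tsupport ψ ⊆ φ.target ×ˢ T →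
      ∫ q, u (φ.symm q.1, q.2) * heatTranspose Ac Jc qc ψ q = ∫ q, Fc q * ψ q :=
    fun ψ hψ hψc hψT ↦ integral_heatTranspose_chart_of_veryWeak_nc hh hR hR₀ hQ hG hT hum hu hweak x₀
      Jc qc Fc Ac (fun _ ↦ rfl) (fun _ _ _ ↦ rfl) (fun _ ↦ rfl) (fun _ ↦ rfl) hψ hψc hψT
  -- Hörmander in the chart
  have hp₀Ω : ((φ x₀, s₀) : (EuclideanSpace ℝ (Fin m) × ℝ)) ∈ φ.target ×ˢ T := ⟨φ.map_source (mem_extChartAt_source x₀), hs₀⟩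
  obtain ⟨U, hUo, hpU, hUΩ, w, hw, hae⟩ := exists_contDiffOn_ae_eq_of_heat_veryWeak hΩ
    (fun k l ↦ (hAcs k l).mono hΩO) hAsymm hApos (hJcs.mono hΩO) hJpos (hqcs.mono hΩO)
    (hFcs.mono hΩO) hū hchart hp₀Ω
  -- pull back
  set V : Set (M × ℝ) := {p | p.1 ∈ φ.source ∧ ((φ p.1, p.2) : (EuclideanSpace ℝ (Fin m) × ℝ)) ∈ U} with hVdef
  have hΦc : ContinuousOn (fun p : M × ℝ ↦ ((φ p.1, p.2) : (EuclideanSpace ℝ (Fin m) × ℝ))) (φ.source ×ˢ (univ : Set ℝ)) :=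
    ((continuousOn_extChartAt x₀).comp continuous_fst.continuousOn
      (fun p hp ↦ hp.1)).prodMk continuous_snd.continuousOn
  have hVo : IsOpen V := by
    have h1 := hΦc.isOpen_inter_preimage ((isOpen_extChartAt_source x₀).prod isOpen_univ) hUo
    have : V = φ.source ×ˢ (univ : Set ℝ) ∩ (fun p : M × ℝ ↦ ((φ p.1, p.2) : (EuclideanSpace ℝ (Fin m) × ℝ))) ⁻¹' U := by
      ext p; simp [hVdef]
    rw [this]; exact h1
  have hpV : ((x₀, s₀) : M × ℝ) ∈ V := ⟨mem_extChartAt_source x₀, hpU⟩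
  have hVT : V ⊆ univ ×ˢ T := fun p hp ↦ ⟨mem_univ _, (hUΩ hp.2).2⟩
  refine ⟨V, hVo, hpV, hVT, fun p ↦ w (φ p.1, p.2), ?_, ?_⟩
  · have hwU : ContMDiffOn 𝓘(ℝ, (EuclideanSpace ℝ (Fin m) × ℝ)) 𝓘(ℝ, ℝ) ∞ w U := contMDiffOn_iff_contDiffOn.2 hw
    have hΦ : ContMDiffOn (I.prod 𝓘(ℝ, ℝ)) 𝓘(ℝ, (EuclideanSpace ℝ (Fin m) × ℝ)) ∞ (fun p : M × ℝ ↦ ((φ p.1, p.2) : (EuclideanSpace ℝ (Fin m) × ℝ))) V :=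
      (contMDiffOn_extChartAt_prod_id x₀ univ).mono fun p hp ↦ ⟨hp.1, mem_univ _⟩
    exact hwU.comp hΦ fun p hp ↦ hp.2
  · have h1 : ∀ᵐ p ∂μ₀.prod (volume : Measure ℝ),
        p.1 ∈ φ.source → ((φ p.1, p.2) : (EuclideanSpace ℝ (Fin m) × ℝ)) ∈ U → u (φ.symm (φ p.1), p.2) = w (φ p.1, p.2) :=
      ae_prod_chart_of_ae_volume_nc hR₀ x₀ (P := fun q : (EuclideanSpace ℝ (Fin m) × ℝ) ↦ q ∈ U → u (φ.symm q.1, q.2) = w q) hae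
    filter_upwards [h1] with p hp hpV
    have h2 := hp hpV.1 hpV.2
    rwa [φ.left_inv hpV.1] at h2


end General

/-! ### The static statement on a manifold modelled on `ℝⁿ` -/

section Static

variable {n : ℕ} {M : Type*} [TopologicalSpace M] [SecondCountableTopology M]
  [ChartedSpace (EuclideanSpace ℝ (Fin n)) M] [IsManifold (𝓡 n) ∞ M] [T3Space M] [MeasurableSpace M]
  [BorelSpace M]
  {g : PseudoRiemannianMetric (𝓡 n) ∞ (EuclideanSpace ℝ (Fin n)) (TangentSpace (𝓡 n) : M → Type _)}

/-- **Hypoellipticity of the heat operator on a non-compact manifold, static metric.** Let `(M, g)` be a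
Riemannian manifold modelled on `ℝⁿ` (Hausdorff, second countable, `T₃`, Borel; NOT assumed compact),
`Q, G` smooth on `M × ℝ`, `T ⊆ ℝ` open, and let `u : M × ℝ → ℝ` be measurable, locally integrable on
`M × T` for `dV_g ⊗ ds`, and a very weak solution of `∂ₛu = Δ_g u − Qu + G`:
`∫ u (−∂ₛζ − Δ_g ζ + Qζ) = ∫ Gζ` for every smooth `ζ` compactly supported in `M × T`. Then `u` agrees
a.e. on `M × T` with a function smooth on `M × T` (`exists_contMDiffOn_ae_eq_of_linearHeat_veryWeak_nc`
for the constant family `h ≡ g`, `g₀ = g`, whose density ratio is `1` since `♯ ∘ ♭ = id`).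
[cite: Hormander1967, Thm 1.1 and p. 147] -/
theorem exists_contMDiffOn_ae_eq_of_staticLinearHeat_veryWeak (hg : g.IsRiemannian) {Q G : ℝ → M → ℝ}
    (hQ : ContMDiff ((𝓡 n).prod 𝓘(ℝ, ℝ)) 𝓘(ℝ, ℝ) ∞ fun p : M × ℝ ↦ Q p.2 p.1)
    (hG : ContMDiff ((𝓡 n).prod 𝓘(ℝ, ℝ)) 𝓘(ℝ, ℝ) ∞ fun p : M × ℝ ↦ G p.2 p.1)
    {T : Set ℝ} (hT : IsOpen T) {u : M × ℝ → ℝ} (hum : Measurable u)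
    (hu : LocallyIntegrableOn u (univ ×ˢ T) (g.riemVolume.prod (volume : Measure ℝ)))
    (hweak : ∀ ζ : M × ℝ → ℝ, ContMDiff ((𝓡 n).prod 𝓘(ℝ, ℝ)) 𝓘(ℝ, ℝ) ∞ ζ → HasCompactSupport ζ →
      tsupport ζ ⊆ univ ×ˢ T →
      ∫ p, u p * (-(deriv (fun s ↦ ζ (p.1, s)) p.2) - g.laplaceBeltrami (fun x ↦ ζ (x, p.2)) p.1 +
          Q p.2 p.1 * ζ p) ∂(g.riemVolume.prod (volume : Measure ℝ)) =
        ∫ p, G p.2 p.1 * ζ p ∂(g.riemVolume.prod (volume : Measure ℝ))) :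
    ∃ v : M × ℝ → ℝ, ContMDiffOn ((𝓡 n).prod 𝓘(ℝ, ℝ)) 𝓘(ℝ, ℝ) ∞ v (univ ×ˢ T) ∧
      ∀ᵐ p ∂(g.riemVolume.prod (volume : Measure ℝ)), p ∈ univ ×ˢ T → u p = v p := by
  -- the density ratio of `g` with respect to itself is `1` (`♯ ∘ ♭ = id`, `det id = 1`)
  have hρ1 : ∀ x : M, g.densityRatio g x = 1 := fun x ↦ by
    have hid : (g.sharp x).toLinearMap ∘ₗ g.flat x = LinearMap.id := by
      apply LinearMap.ext
      intro v
      simp only [LinearMap.coe_comp, comp_apply, LinearMap.id_coe, id_eq, LinearEquiv.coe_coe]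
      exact g.sharp_flat x v
    rw [densityRatio_def, hid, LinearMap.det_id, Real.sqrt_one]
  refine exists_contMDiffOn_ae_eq_of_linearHeat_veryWeak_nc (h := fun _ ↦ g) (g₀ := g)
    (isContMDiffFamilyOn_const g univ) (fun _ ↦ hg) hg hQ hG hT hum hu ?_
  intro ζ hζ hζc hζT
  simp only [hρ1, one_mul]
  exact hweak ζ hζ hζc hζT

end Static

end Literature.Geometry.Riemannian

end
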